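import Literature.AlgebraicGeometry.Motives.CartierDivisorPrincipalTrivialisation
import HarnessLib

/-!
# Linearly equivalent Cartier divisors have isomorphic glued line bundles — as SPECIFIC isomorphisms
# (Görtz–Wedhorn I, (11.9) / Prop. 11.21: multiplication by a rational function `𝒪_Y(D) ≅ 𝒪_Y(E)`; `DivCl(X) ⥲ Pic(X)`)

Layer `Literature/AlgebraicGeometry/Motives`, namespace `Literature.AlgebraicGeometry.Motives.CartierDivisor` (dot
notation on `D`). DEFINITIONS WITH BODIES AND THEOREMS ONLY (no named fact, no instance, no notation, no `sorry`);
everything is proved. Sequel of ★ `Motives/CartierDivisorPrincipalTrivialisation` (the case `E = 0`, target `𝒪_Y`).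

For Cartier divisors `D = (U_i, f_i)`, `E = (V_j, g_j)` on an integral scheme `Y` and a rational function `m` with
`g_j · m / f_i ∈ Γ(U_i ∩ V_j, 𝒪_Y^×)` for all `i, j` — i.e. `E` is the same divisor as `D + div(m⁻¹)`, `D ∼ E` — the tree has
the isomorphism of GLOBAL sections `Γ(Y, 𝒪_Y(D)) ≅ Γ(Y, 𝒪_Y(E))`, `s ↦ s · m` (★ `CartierDivisor.sectionsEquivOfLinEquiv` with
`m = h⁻¹`; [GortzWedhorn2020] (11.9) p. 301 «multiplication by `f` defines an isomorphism» and Prop. 11.21 p. 302: `D ↦ 𝒪_X(D)`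
induces `DivCl(X) ⥲ Pic(X)`, so linearly equivalent divisors have isomorphic line bundles) and the CLASS-level statement `Nonempty (𝒪(D) ≅ 𝒪(E))` through Čech classes (★ `Modules/RankOneCocycleIso`). This file constructs the
isomorphism of the glued `𝒪_Y`-MODULES (★ `Modules/LineBundleOfCocycle`) itself, with its action on sections read in `K(Y)`
(★ `CartierDivisor.lineBundleRatFn`):

* `CartierDivisor.ratFnMulIso D E m hm : Modules.lineBundle D.toUnitCocycle ≅ Modules.lineBundle E.toUnitCocycle` —
  **multiplication by `m`**: `φ_E(iso s) = φ_D(s) · m` (`lineBundleRatFn_ratFnMulIso_hom_app`), inverse = multiplication by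
  `m⁻¹` (`lineBundleRatFn_ratFnMulIso_inv_app`);
* the two named special cases: `linEquivIso hh H` for `E` the same divisor as `D + div(h)` (hypothesis literally that of ★
  `sectionsEquivOfLinEquiv`: `f_i h / g_j` units; the iso is `s ↦ s · h⁻¹`) and `sameDivisorIso H` for `D.SameDivisor E`
  (`m = 1`: SAME rational functions, `φ_E(iso s) = φ_D(s)`);
* **faithfulness**: a morphism `𝒪_Y(D) ⟶ 𝒪_Y(E)` is determined by the rational functions of its values
  (`hom_ext_lineBundleRatFn`), so an isomorphism with `φ_E(e s) = φ_D(s) · m` IS `ratFnMulIso D E m` (`eq_ratFnMulIso`), and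
  composition of multiplications is multiplication by the product (`ratFnMulIso_trans`).

Engines (all ★ / Mathlib): `CartierDivisor.lineBundleSectionOfRatFn` / `lineBundleRatFn_lineBundleSectionOfRatFn` and the
additivity / semilinearity / restriction rules of `lineBundleRatFn` (★ `CartierDivisorLineBundleSectionsOn`),
`CartierDivisor.lineBundle_section_ext` (★ `CartierDivisorPrincipalTrivialisation`), Mathlib `PresheafOfModules.homMk`,
`Scheme.Modules.hom_ext`. Mathlib searched (pin): no Cartier divisors / `𝒪_X(D)` / `Pic` for schemes.

Consumers: every «`𝒪(D) ≅ 𝒪(E)` from `D ∼ E`» step of the cell hodgecm-mathlib (h9-S)/(D-2) dictionary (★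
`AbelianSchemeDualTransportLambda`, `CartierDivisorClassPullback`, `IsLambdaOfAt*`), today class-level only. Count-neutral;
HC_CM is proved only modulo the 7 printed citations until rung 0 closes.

## References
* [GortzWedhorn2020] U. Görtz, T. Wedhorn, *Algebraic Geometry I: Schemes*, 2nd ed., Springer Spektrum (2020): Section
  (11.9) «Divisors on integral schemes» (p. 301: `𝒪_X(D)`, `D + div(f)`, linear equivalence), Prop. 11.21 (p. 302),
  (`D ↦ 𝒪_X(D)` induces `DivCl(X) ⥲ Pic(X)`: linearly equivalent divisors ↔ isomorphic line bundles), Prop. 3.29 (2)(3) (p. 80).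
-/

noncomputable section

open CategoryTheory AlgebraicGeometry Opposite TopologicalSpace

namespace Literature.AlgebraicGeometry.Motives.CartierDivisor

open RatFn Literature.AlgebraicGeometry.Modules

universe u

variable {Y : Scheme.{u}} [IsIntegral Y] (D E F : CartierDivisor Y)

/-! ### §0 Morphisms `𝒪_Y(D) ⟶ 𝒪_Y(E)` are determined by rational functions -/

/-- **A morphism `Modules.lineBundle D.toUnitCocycle ⟶ Modules.lineBundle E.toUnitCocycle` is determined by the rational
functions of its values** on sections over non-empty opens. [cite: GortzWedhorn2020, Section (11.9) (p. 301) with Prop. 3.29 (2) (p. 80)] -/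
theorem hom_ext_lineBundleRatFn {φ ψ : Modules.lineBundle D.toUnitCocycle ⟶ Modules.lineBundle E.toUnitCocycle}
    (H : ∀ (W : Y.Opens) (hW : genericPoint Y ∈ W) (s : Γ(Modules.lineBundle D.toUnitCocycle, W)),
      E.lineBundleRatFn hW (φ.app W s) = E.lineBundleRatFn hW (ψ.app W s)) :
    φ = ψ :=
  Scheme.Modules.hom_ext _ _ fun W => AddCommGrpCat.ext fun s => E.lineBundle_section_ext fun hW => H W hW s

variable (m : Y.functionField)
  (hm : ∀ (i : D.ι) (j : E.ι) (x : Y), x ∈ D.U i → x ∈ E.U j → IsUnitAt x (E.f j * m / D.f i))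

/-- The hypothesis `g_j m / f_i ∈ 𝒪^×` is symmetric under `(D, E, m) ↦ (E, D, m⁻¹)`. [cite: GortzWedhorn2020, Section (11.9) (p. 301)] -/
theorem isUnitAt_mul_inv_div_of (hm : ∀ (i : D.ι) (j : E.ι) (x : Y), x ∈ D.U i → x ∈ E.U j → IsUnitAt x (E.f j * m / D.f i))
    (j : E.ι) (i : D.ι) (x : Y) (hj : x ∈ E.U j) (hi : x ∈ D.U i) : IsUnitAt x (D.f i * m⁻¹ / E.f j) := by
  -- `m ≠ 0`: `g_j m / f_i` is a unit at `x`
  have hm0 : m ≠ 0 := fun h0 => (hm i j x hi hj).ne_zero (by rw [h0, mul_zero, zero_div])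
  have hf := D.f_ne_zero i
  have hg := E.f_ne_zero j
  convert (hm i j x hi hj).inv using 2
  rw [inv_div, div_eq_div_iff hg (mul_ne_zero hg hm0)]
  field_simp

/-! ### §1 Multiplication by `m`: `𝒪_Y(D) → 𝒪_Y(E)` -/

open scoped Classical in
/-- The value of multiplication by `m` on a section `s` of `𝒪_Y(D)` over `W`: the section of `𝒪_Y(E)` with rational function
`φ_D(s) · m` (`g_j φ_D(s) m = (g_j m / f_i)(f_i φ_D(s))` is regular on `W ∩ V_j`; junk `0` over `W = ∅`).
[cite: GortzWedhorn2020, Section (11.9) (p. 301)] -/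
def ratFnMulFun {W : Y.Opens} (s : Γ(Modules.lineBundle D.toUnitCocycle, W)) :
    Γ(Modules.lineBundle E.toUnitCocycle, W) :=
  if hW : genericPoint Y ∈ W then
    E.lineBundleSectionOfRatFn hW (D.lineBundleRatFn hW s * m) fun j z hj hz => by
      have h1 := (D.isSectionOn_lineBundleRatFn hW s) (D.chartIdx z) z (D.mem_U_chartIdx z) hz
      have h2 := (hm (D.chartIdx z) j z (D.mem_U_chartIdx z) hj).isRegularAt
      have e : E.f j * (D.lineBundleRatFn hW s * m) =
          E.f j * m / D.f (D.chartIdx z) * (D.f (D.chartIdx z) * D.lineBundleRatFn hW s) := by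
        field_simp [D.f_ne_zero (D.chartIdx z)]
      rw [e]
      exact h2.mul h1
  else 0

/-- The rational function of `ratFnMulFun s` is `φ_D(s) · m`. [cite: GortzWedhorn2020, Section (11.9) (p. 301)] -/
theorem lineBundleRatFn_ratFnMulFun {W : Y.Opens} (hW : genericPoint Y ∈ W)
    (s : Γ(Modules.lineBundle D.toUnitCocycle, W)) :
    E.lineBundleRatFn hW (D.ratFnMulFun E m hm s) = D.lineBundleRatFn hW s * m := by
  simp only [ratFnMulFun, dif_pos hW]
  exact E.lineBundleRatFn_lineBundleSectionOfRatFn hW _ _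

/-- `ratFnMulFun` is additive. [cite: GortzWedhorn2020, Section (11.9) (p. 301)] -/
theorem ratFnMulFun_add {W : Y.Opens} (s t : Γ(Modules.lineBundle D.toUnitCocycle, W)) :
    D.ratFnMulFun E m hm (s + t) = D.ratFnMulFun E m hm s + D.ratFnMulFun E m hm t :=
  E.lineBundle_section_ext fun hW => by
    rw [lineBundleRatFn_add, lineBundleRatFn_ratFnMulFun, lineBundleRatFn_ratFnMulFun, lineBundleRatFn_ratFnMulFun,
      lineBundleRatFn_add, add_mul]

/-- `ratFnMulFun 0 = 0`. [cite: GortzWedhorn2020, Section (11.9) (p. 301)] -/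
theorem ratFnMulFun_zero {W : Y.Opens} :
    D.ratFnMulFun E m hm (0 : Γ(Modules.lineBundle D.toUnitCocycle, W)) = 0 :=
  E.lineBundle_section_ext fun hW => by
    rw [lineBundleRatFn_ratFnMulFun, lineBundleRatFn_zero, lineBundleRatFn_zero, zero_mul]

/-- `ratFnMulFun` is `Γ(W, 𝒪_Y)`-linear. [cite: GortzWedhorn2020, Section (11.9) (p. 301)] -/
theorem ratFnMulFun_smul {W : Y.Opens} (b : Γ(Y, W)) (s : Γ(Modules.lineBundle D.toUnitCocycle, W)) :
    D.ratFnMulFun E m hm (b • s) = b • D.ratFnMulFun E m hm s :=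
  E.lineBundle_section_ext fun hW => by
    rw [lineBundleRatFn_smul, lineBundleRatFn_ratFnMulFun, lineBundleRatFn_ratFnMulFun, lineBundleRatFn_smul, mul_assoc]

/-- `ratFnMulFun` is compatible with restriction. [cite: GortzWedhorn2020, Section (11.9) (p. 301)] -/
theorem ratFnMulFun_map {W W' : Y.Opens} (i : W' ⟶ W) (s : Γ(Modules.lineBundle D.toUnitCocycle, W)) :
    D.ratFnMulFun E m hm ((Modules.lineBundle D.toUnitCocycle).presheaf.map i.op s) =
      (Modules.lineBundle E.toUnitCocycle).presheaf.map i.op (D.ratFnMulFun E m hm s) :=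
  E.lineBundle_section_ext fun hW' => by
    rw [lineBundleRatFn_ratFnMulFun, lineBundleRatFn_map, lineBundleRatFn_map, lineBundleRatFn_ratFnMulFun]

/-- **Multiplication by `m`, `𝒪_Y(D) → 𝒪_Y(E)`**, as a morphism of `𝒪_Y`-modules.
[cite: GortzWedhorn2020, Section (11.9) (p. 301) and Prop. 11.21 (p. 302)] -/
def ratFnMulHom : Modules.lineBundle D.toUnitCocycle ⟶ Modules.lineBundle E.toUnitCocycle where
  val := PresheafOfModules.homMk
    { app := fun W => AddCommGrpCat.ofHom
        { toFun := fun s => D.ratFnMulFun E m hm (W := W.unop) s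
          map_zero' := D.ratFnMulFun_zero E m hm
          map_add' := fun s t => D.ratFnMulFun_add E m hm s t }
      naturality := fun {W W'} i => by
        ext s
        exact D.ratFnMulFun_map E m hm i.unop s }
    (fun W b s => D.ratFnMulFun_smul E m hm (W := W.unop) b s)

/-- The values of `ratFnMulHom` (definitional). [cite: GortzWedhorn2020, Section (11.9) (p. 301)] -/
@[simp]
theorem ratFnMulHom_app {W : Y.Opens} (s : Γ(Modules.lineBundle D.toUnitCocycle, W)) :
    (D.ratFnMulHom E m hm).app W s = D.ratFnMulFun E m hm s := rfl

/-- The rational functions of the values of `ratFnMulHom`: `φ_E = φ_D · m`. [cite: GortzWedhorn2020, Section (11.9) (p. 301)] -/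
theorem lineBundleRatFn_ratFnMulHom_app {W : Y.Opens} (hW : genericPoint Y ∈ W)
    (s : Γ(Modules.lineBundle D.toUnitCocycle, W)) :
    E.lineBundleRatFn hW ((D.ratFnMulHom E m hm).app W s) = D.lineBundleRatFn hW s * m :=
  D.lineBundleRatFn_ratFnMulFun E m hm hW s

/-- Multiplication by `m` then by `m⁻¹` is the identity. [cite: GortzWedhorn2020, Section (11.9) (p. 301)] -/
theorem ratFnMulHom_comp_ratFnMulHom_inv :
    D.ratFnMulHom E m hm ≫ E.ratFnMulHom D m⁻¹ (D.isUnitAt_mul_inv_div_of E m hm) = 𝟙 _ := by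
  -- `m ≠ 0`: the hypothesis at the generic point
  obtain ⟨i, hi⟩ := D.covers (genericPoint Y)
  obtain ⟨j, hj⟩ := E.covers (genericPoint Y)
  have hm0 : m ≠ 0 := fun h0 => (hm i j _ hi hj).ne_zero (by rw [h0, mul_zero, zero_div])
  refine D.hom_ext_lineBundleRatFn D fun W hW s => ?_
  change D.lineBundleRatFn hW (E.ratFnMulFun D m⁻¹ (D.isUnitAt_mul_inv_div_of E m hm) (D.ratFnMulFun E m hm s)) =
    D.lineBundleRatFn hW s
  rw [lineBundleRatFn_ratFnMulFun, lineBundleRatFn_ratFnMulFun, mul_inv_cancel_right₀ hm0]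

/-- **THE ISOMORPHISM `𝒪_Y(D) ≅ 𝒪_Y(E)` GIVEN BY MULTIPLICATION BY `m`**, for a rational function `m` with
`g_j · m / f_i ∈ Γ(U_i ∩ V_j, 𝒪_Y^×)` (i.e. `E` is the same divisor as `D - div(m)`; [GortzWedhorn2020] (11.9) /
Prop. 11.21: linearly equivalent divisors have isomorphic line bundles, the isomorphism being multiplication by the rational
function).
[cite: GortzWedhorn2020, Section (11.9) (p. 301) and Prop. 11.21 (p. 302)] -/
def ratFnMulIso : Modules.lineBundle D.toUnitCocycle ≅ Modules.lineBundle E.toUnitCocycle where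
  hom := D.ratFnMulHom E m hm
  inv := E.ratFnMulHom D m⁻¹ (D.isUnitAt_mul_inv_div_of E m hm)
  hom_inv_id := D.ratFnMulHom_comp_ratFnMulHom_inv E m hm
  inv_hom_id := by
    have h := E.ratFnMulHom_comp_ratFnMulHom_inv D m⁻¹ (D.isUnitAt_mul_inv_div_of E m hm)
    -- the double inverse hypothesis is `hm` again up to `m⁻¹⁻¹ = m` (proof-irrelevant after `simp only`)
    simp only [inv_inv] at h
    exact h

/-- **`φ_E(e_m s) = φ_D(s) · m`** for every section `s` of `𝒪_Y(D)` over a non-empty open.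
[cite: GortzWedhorn2020, Section (11.9) (p. 301) and Prop. 11.21 (p. 302)] -/
theorem lineBundleRatFn_ratFnMulIso_hom_app {W : Y.Opens} (hW : genericPoint Y ∈ W)
    (s : Γ(Modules.lineBundle D.toUnitCocycle, W)) :
    E.lineBundleRatFn hW ((D.ratFnMulIso E m hm).hom.app W s) = D.lineBundleRatFn hW s * m :=
  D.lineBundleRatFn_ratFnMulFun E m hm hW s

/-- **`φ_D(e_m⁻¹ t) = φ_E(t) · m⁻¹`** for every section `t` of `𝒪_Y(E)` over a non-empty open.
[cite: GortzWedhorn2020, Section (11.9) (p. 301) and Prop. 11.21 (p. 302)] -/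
theorem lineBundleRatFn_ratFnMulIso_inv_app {W : Y.Opens} (hW : genericPoint Y ∈ W)
    (t : Γ(Modules.lineBundle E.toUnitCocycle, W)) :
    D.lineBundleRatFn hW ((D.ratFnMulIso E m hm).inv.app W t) = E.lineBundleRatFn hW t * m⁻¹ :=
  E.lineBundleRatFn_ratFnMulFun D m⁻¹ (D.isUnitAt_mul_inv_div_of E m hm) hW t

/-! ### §2 Faithfulness and composition -/

/-- **An isomorphism `e : 𝒪_Y(D) ≅ 𝒪_Y(E)` with `φ_E(e s) = φ_D(s) · m` for all sections IS `ratFnMulIso D E m`.**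
[cite: GortzWedhorn2020, Prop. 11.21 (p. 302) with Prop. 3.29 (2) (p. 80)] -/
theorem eq_ratFnMulIso (e : Modules.lineBundle D.toUnitCocycle ≅ Modules.lineBundle E.toUnitCocycle)
    (he : ∀ (W : Y.Opens) (hW : genericPoint Y ∈ W) (s : Γ(Modules.lineBundle D.toUnitCocycle, W)),
      E.lineBundleRatFn hW (e.hom.app W s) = D.lineBundleRatFn hW s * m) :
    e = D.ratFnMulIso E m hm :=
  Iso.ext (D.hom_ext_lineBundleRatFn E fun W hW s => by rw [he, lineBundleRatFn_ratFnMulIso_hom_app])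

/-- A morphism `ψ : 𝒪_Y(D) ⟶ 𝒪_Y(E)` with `φ_E(ψ s) = φ_D(s) · m` for all sections is the `hom` of `ratFnMulIso D E m` (in
particular an isomorphism). [cite: GortzWedhorn2020, Prop. 11.21 (p. 302) with Prop. 3.29 (2) (p. 80)] -/
theorem eq_ratFnMulIso_hom (ψ : Modules.lineBundle D.toUnitCocycle ⟶ Modules.lineBundle E.toUnitCocycle)
    (hψ : ∀ (W : Y.Opens) (hW : genericPoint Y ∈ W) (s : Γ(Modules.lineBundle D.toUnitCocycle, W)),
      E.lineBundleRatFn hW (ψ.app W s) = D.lineBundleRatFn hW s * m) :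
    ψ = (D.ratFnMulIso E m hm).hom :=
  D.hom_ext_lineBundleRatFn E fun W hW s => by rw [hψ, lineBundleRatFn_ratFnMulIso_hom_app]

/-- **Composition**: multiplication by `m` then by `m'` is multiplication by `m · m'`.
[cite: GortzWedhorn2020, Section (11.9) (p. 301) and Prop. 11.21 (p. 302)] -/
theorem ratFnMulIso_trans (m' : Y.functionField)
    (hm' : ∀ (j : E.ι) (k : F.ι) (x : Y), x ∈ E.U j → x ∈ F.U k → IsUnitAt x (F.f k * m' / E.f j))
    (hmm' : ∀ (i : D.ι) (k : F.ι) (x : Y), x ∈ D.U i → x ∈ F.U k → IsUnitAt x (F.f k * (m * m') / D.f i)) :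
    D.ratFnMulIso E m hm ≪≫ E.ratFnMulIso F m' hm' = D.ratFnMulIso F (m * m') hmm' :=
  D.eq_ratFnMulIso F (m * m') hmm' _ fun W hW s => by
    rw [Iso.trans_hom, Scheme.Modules.Hom.comp_app]
    change F.lineBundleRatFn hW ((E.ratFnMulIso F m' hm').hom.app W ((D.ratFnMulIso E m hm).hom.app W s)) = _
    rw [lineBundleRatFn_ratFnMulIso_hom_app, lineBundleRatFn_ratFnMulIso_hom_app, mul_assoc]

include hm in
/-- The product hypothesis needed by `ratFnMulIso_trans` holds (test through a chart `V_j ∋ x` of `E`).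
[cite: GortzWedhorn2020, Section (11.9) (p. 301)] -/
theorem isUnitAt_mul_mul_div (m' : Y.functionField)
    (hm' : ∀ (j : E.ι) (k : F.ι) (x : Y), x ∈ E.U j → x ∈ F.U k → IsUnitAt x (F.f k * m' / E.f j))
    (i : D.ι) (k : F.ι) (x : Y) (hi : x ∈ D.U i) (hk : x ∈ F.U k) : IsUnitAt x (F.f k * (m * m') / D.f i) := by
  obtain ⟨j, hj⟩ := E.covers x
  convert (hm i j x hi hj).mul (hm' j k x hj hk) using 1
  field_simp [E.f_ne_zero j]

/-! ### §3 Linear equivalence and same divisor -/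

variable {D E}

/-- The hypothesis of ★ `sectionsEquivOfLinEquiv` (`f_i h / g_j` units: `E` is the same divisor as `D + div(h)`) is the
`m = h⁻¹` instance of the multiplication hypothesis. [cite: GortzWedhorn2020, Section (11.9) (p. 301) and Def. 11.26] -/
theorem isUnitAt_mul_inv_div_of_linEquivWith {h : Y.functionField}
    (H : ∀ (i : D.ι) (j : E.ι) (x : Y), x ∈ D.U i → x ∈ E.U j → IsUnitAt x (D.f i * h / E.f j))
    (i : D.ι) (j : E.ι) (x : Y) (hi : x ∈ D.U i) (hj : x ∈ E.U j) : IsUnitAt x (E.f j * h⁻¹ / D.f i) := by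
  have hh0 : h ≠ 0 := fun h0 => (H i j x hi hj).ne_zero (by rw [h0, mul_zero, zero_div])
  have hf := D.f_ne_zero i
  have hg := E.f_ne_zero j
  convert (H i j x hi hj).inv using 2
  rw [inv_div, div_eq_div_iff hf (mul_ne_zero hf hh0)]
  field_simp

variable (D E) in
/-- **`𝒪_Y(D) ≅ 𝒪_Y(E)` for `E` the same divisor as `D + div(h)`, `s ↦ s · h⁻¹`** — the sheaf form of ★
`CartierDivisor.sectionsEquivOfLinEquiv` ([GortzWedhorn2020] (11.9) p. 301: «multiplication by `f` defines an isomorphism»;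
Prop. 11.21 p. 302: `D ∼ E ⇒ 𝒪_X(D) ≅ 𝒪_X(E)`). [cite: GortzWedhorn2020, Section (11.9) (p. 301) and Prop. 11.21 (p. 302)] -/
def linEquivIso (h : Y.functionField)
    (H : ∀ (i : D.ι) (j : E.ι) (x : Y), x ∈ D.U i → x ∈ E.U j → IsUnitAt x (D.f i * h / E.f j)) :
    Modules.lineBundle D.toUnitCocycle ≅ Modules.lineBundle E.toUnitCocycle :=
  D.ratFnMulIso E h⁻¹ (isUnitAt_mul_inv_div_of_linEquivWith H)

/-- `linEquivIso` on sections: `φ_E(e s) = φ_D(s) · h⁻¹` (as ★ `sectionsEquivOfLinEquiv`: `s ↦ s h⁻¹`).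
[cite: GortzWedhorn2020, Section (11.9) (p. 301) and Prop. 11.21 (p. 302)] -/
theorem lineBundleRatFn_linEquivIso_hom_app {h : Y.functionField}
    (H : ∀ (i : D.ι) (j : E.ι) (x : Y), x ∈ D.U i → x ∈ E.U j → IsUnitAt x (D.f i * h / E.f j))
    {W : Y.Opens} (hW : genericPoint Y ∈ W) (s : Γ(Modules.lineBundle D.toUnitCocycle, W)) :
    E.lineBundleRatFn hW ((linEquivIso D E h H).hom.app W s) = D.lineBundleRatFn hW s * h⁻¹ :=
  D.lineBundleRatFn_ratFnMulIso_hom_app E h⁻¹ _ hW s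

/-- `linEquivIso⁻¹` on sections: `φ_D(e⁻¹ t) = φ_E(t) · h`. [cite: GortzWedhorn2020, Section (11.9) (p. 301) and Prop. 11.21 (p. 302)] -/
theorem lineBundleRatFn_linEquivIso_inv_app {h : Y.functionField}
    (H : ∀ (i : D.ι) (j : E.ι) (x : Y), x ∈ D.U i → x ∈ E.U j → IsUnitAt x (D.f i * h / E.f j))
    {W : Y.Opens} (hW : genericPoint Y ∈ W) (t : Γ(Modules.lineBundle E.toUnitCocycle, W)) :
    D.lineBundleRatFn hW ((linEquivIso D E h H).inv.app W t) = E.lineBundleRatFn hW t * h := by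
  rw [linEquivIso, lineBundleRatFn_ratFnMulIso_inv_app, inv_inv]

/-- **Linearly equivalent divisors have isomorphic glued line bundles** ([GortzWedhorn2020] Prop. 11.21), now with a
NAMED isomorphism behind the `Nonempty`. [cite: GortzWedhorn2020, Prop. 11.21 (p. 302)] -/
theorem LinEquiv.nonempty_lineBundle_iso (H : D.LinEquiv E) :
    Nonempty (Modules.lineBundle D.toUnitCocycle ≅ Modules.lineBundle E.toUnitCocycle) := by
  obtain ⟨h, -, H⟩ := (linEquiv_iff D E).1 H
  exact ⟨linEquivIso D E h H⟩

/-- `D.SameDivisor E` (`f_i / g_j` units) is the `m = 1` instance of the multiplication hypothesis.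
[cite: GortzWedhorn2020, Def. 11.20 and Section (11.9) (p. 301)] -/
theorem SameDivisor.isUnitAt_mul_one_div (H : D.SameDivisor E) (i : D.ι) (j : E.ι) (x : Y) (hi : x ∈ D.U i)
    (hj : x ∈ E.U j) : IsUnitAt x (E.f j * 1 / D.f i) := by
  rw [mul_one, ← inv_div]
  exact (H i j x hi hj).inv

variable (D E) in
/-- **Two presentations of the SAME divisor have CANONICALLY isomorphic glued line bundles**: the isomorphism preserving
rational functions (`m = 1`). [cite: GortzWedhorn2020, Def. 11.20 and Section (11.9) (p. 301)] -/
def sameDivisorIso (H : D.SameDivisor E) :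
    Modules.lineBundle D.toUnitCocycle ≅ Modules.lineBundle E.toUnitCocycle :=
  D.ratFnMulIso E 1 (SameDivisor.isUnitAt_mul_one_div H)

/-- `sameDivisorIso` preserves rational functions: `φ_E(e s) = φ_D(s)`. [cite: GortzWedhorn2020, Section (11.9) (p. 301)] -/
theorem lineBundleRatFn_sameDivisorIso_hom_app (H : D.SameDivisor E) {W : Y.Opens} (hW : genericPoint Y ∈ W)
    (s : Γ(Modules.lineBundle D.toUnitCocycle, W)) :
    E.lineBundleRatFn hW ((sameDivisorIso D E H).hom.app W s) = D.lineBundleRatFn hW s := by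
  rw [sameDivisorIso, lineBundleRatFn_ratFnMulIso_hom_app, mul_one]

/-- `sameDivisorIso⁻¹` preserves rational functions: `φ_D(e⁻¹ t) = φ_E(t)`. [cite: GortzWedhorn2020, Section (11.9) (p. 301)] -/
theorem lineBundleRatFn_sameDivisorIso_inv_app (H : D.SameDivisor E) {W : Y.Opens} (hW : genericPoint Y ∈ W)
    (t : Γ(Modules.lineBundle E.toUnitCocycle, W)) :
    D.lineBundleRatFn hW ((sameDivisorIso D E H).inv.app W t) = E.lineBundleRatFn hW t := by
  rw [sameDivisorIso, lineBundleRatFn_ratFnMulIso_inv_app, inv_one, mul_one]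

/-- An isomorphism `𝒪_Y(D) ≅ 𝒪_Y(E)` preserving rational functions IS `sameDivisorIso` (uniqueness of the canonical
identification of two presentations). [cite: GortzWedhorn2020, Section (11.9) (p. 301) with Prop. 3.29 (2) (p. 80)] -/
theorem eq_sameDivisorIso (H : D.SameDivisor E)
    (e : Modules.lineBundle D.toUnitCocycle ≅ Modules.lineBundle E.toUnitCocycle)
    (he : ∀ (W : Y.Opens) (hW : genericPoint Y ∈ W) (s : Γ(Modules.lineBundle D.toUnitCocycle, W)),
      E.lineBundleRatFn hW (e.hom.app W s) = D.lineBundleRatFn hW s) :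
    e = sameDivisorIso D E H :=
  D.eq_ratFnMulIso E 1 _ e fun W hW s => by rw [he, mul_one]

/-! ### §4 Compatibility with the trivialisations of `CartierDivisorPrincipalTrivialisation` -/

/-- **Multiplication by `m` followed by the trivialisation `𝒪_Y(E) ≅ 𝒪_Y` by `h` is the trivialisation of `𝒪_Y(D)` by
`m · h`** (all read in `K(Y)`). [cite: GortzWedhorn2020, Prop. 11.21 (p. 302)] -/
theorem ratFnMulIso_trans_unitIsoOfRatFn (h : Y.functionField)
    (hE : ∀ (j : E.ι) (x : Y), x ∈ E.U j → IsUnitAt x (h / E.f j))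
    (hD : ∀ (i : D.ι) (x : Y), x ∈ D.U i → IsUnitAt x (m * h / D.f i)) :
    D.ratFnMulIso E m hm ≪≫ E.unitIsoOfRatFn h hE = D.unitIsoOfRatFn (m * h) hD :=
  D.eq_unitIsoOfRatFn (m * h) hD _ fun W hW s => by
    rw [Iso.trans_hom, Scheme.Modules.Hom.comp_app]
    change ofSection hW (show Γ(Y, W) from
      (E.unitIsoOfRatFn h hE).hom.app W ((D.ratFnMulIso E m hm).hom.app W s)) = _
    rw [ofSection_unitIsoOfRatFn_hom_app, lineBundleRatFn_ratFnMulIso_hom_app, mul_assoc]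

include hm in
/-- The hypothesis of `ratFnMulIso_trans_unitIsoOfRatFn` holds (test through a chart of `E`).
[cite: GortzWedhorn2020, Section (11.9) (p. 301)] -/
theorem isUnitAt_mul_div_of_unit (h : Y.functionField)
    (hE : ∀ (j : E.ι) (x : Y), x ∈ E.U j → IsUnitAt x (h / E.f j)) (i : D.ι) (x : Y) (hi : x ∈ D.U i) :
    IsUnitAt x (m * h / D.f i) := by
  obtain ⟨j, hj⟩ := E.covers x
  convert (hm i j x hi hj).mul (hE j x hj) using 1
  field_simp [E.f_ne_zero j]

end Literature.AlgebraicGeometry.Motives.CartierDivisor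

end
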